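import Summits.SmoothPoincare4.SmoothPoincare4.Theorems.SullivanDualWitnessChargeHelperMemberGraph
import Summits.SmoothPoincare4.SmoothPoincare4.Theorems.SullivanDualWitnessChargeHelperProperHoloDegreeOne

/-!
# (P3)(a) Graph structure of pencil members — unconditional form

Crux `WitnessCharge` (stmt-SmoothPoincare4-7824, route `SullivanDual`), line `Sketch`, registered
helper `helper_memberGraph` (lead, cycle 2): `helper_memberGraph_of` (p120822) with its degree-theory
hypothesis discharged by `helper_properHolo_degreeOne`.

For `J` standard on the punctured `ε'`-chart-ball and a pencil member `u` of intercept `b`, and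
every `R > ε'⁻¹`, the flat coordinate `z ∘ u` maps `{ξ ∈ u⁻¹(B_ε') | R < |z(u ξ)|}` bijectively,
with non-vanishing derivative, onto `{R < |z|}`: the part of the member in the flat region over
`{R < |z|}` is a single-sheeted holomorphic graph (its graph function is
`helper_memberGraphFunction`, p119513). No `J`-curve theory enters: holomorphy in the end (E0),
the removable singularity at infinity, univalence near infinity, and the degree theory of proper
holomorphic maps of one variable (card `Cruxes/WitnessCharge/Lines/Sketch.md`, (P3)).
-/

noncomputable section

set_option linter.dupNamespace false

open scoped Manifold ContDiff Topology
open Set Filter Literature.Geometry.Kaehler Literature.Geometry.Symplectic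
  Literature.Topology.FourManifolds

namespace Summit.SmoothPoincare4.SmoothPoincare4.Theorems.WitnessCharge.PencilIncompleteness

/-- **(P3)(a) — the flat part of a pencil member over `{R < |z|}` is a graph.** For `J`
standard on the punctured `ε'`-chart-ball at `p` (closed ball inside the chart target), a pencil
member `u` with intercept `b`, and `R > ε'⁻¹`: `ξ ↦ z(u ξ) = (Ycoord p (u ξ)).1` is a bijection
from `{ξ | u ξ ∈ B_ε', R < |z(u ξ)|}` onto `{z | R < |z|}` with non-vanishing derivative. -/
theorem helper_memberGraph :
    ∀ (S : HomotopySphere 4) (p : S.carrier)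
      (J : ∀ x : punctured p, TangentSpace (𝓡 4) x →L[ℝ] TangentSpace (𝓡 4) x) (ε' : ℝ)
      (u : ℂ → punctured p) (b : ℂ),
      0 < ε' →
      Metric.closedBall (extChartAt (𝓡 4) p p) ε' ⊆ (extChartAt (𝓡 4) p).target →
      (∀ x : punctured p, InPuncturedChartBall p ε' x →
        ∀ (v : TangentSpace (𝓡 4) x) (b : EuclideanSpace ℝ (Fin 4)),
          inner ℝ (fderiv ℝ inversion (extChartAt (𝓡 4) p x.1 - extChartAt (𝓡 4) p p)
            (mfderiv (𝓡 4) 𝓘(ℝ, EuclideanSpace ℝ (Fin 4))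
              (fun z : punctured p => extChartAt (𝓡 4) p z.1) x (J x v))) b
          = stdSymplecticForm (fderiv ℝ inversion (extChartAt (𝓡 4) p x.1 - extChartAt (𝓡 4) p p)
            (mfderiv (𝓡 4) 𝓘(ℝ, EuclideanSpace ℝ (Fin 4))
              (fun z : punctured p => extChartAt (𝓡 4) p z.1) x v)) b) →
      IsPencilMember J u b →
      ∀ R : ℝ, ε'⁻¹ < R →
        BijOn (fun ξ : ℂ => (Ycoord p (u ξ)).1)
          {ξ : ℂ | InPuncturedChartBall p ε' (u ξ) ∧ R < ‖(Ycoord p (u ξ)).1‖} {z : ℂ | R < ‖z‖} ∧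
        ∀ ξ : ℂ, InPuncturedChartBall p ε' (u ξ) → R < ‖(Ycoord p (u ξ)).1‖ →
          deriv (fun ξ : ℂ => (Ycoord p (u ξ)).1) ξ ≠ 0 :=
  helper_memberGraph_of helper_properHolo_degreeOne

end Summit.SmoothPoincare4.SmoothPoincare4.Theorems.WitnessCharge.PencilIncompleteness
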